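import Summits.Ventures.HodgeRepro2.T5BergmanModelUnitary

/-!
# The polarised Parseval identity: the Bergman pairing of two functions is the `ℓ²`-form of their
Taylor coefficients

`T5BergmanParseval.hasSum_pairing_self` is Parseval on the diagonal, `⟨f,f⟩_k = Σ |aₙ|² ⟨zⁿ,zⁿ⟩_k`.
This file proves the polarised form for two holomorphic `f = Σ aₙ zⁿ`, `g = Σ bₙ zⁿ` in `A_k`:

  `⟨f, g⟩_k = Σₙ aₙ conj(bₙ) ⟨zⁿ, zⁿ⟩_k`   (as a `HasSum`, `hasSum_pairing`),

by passing to the limit in the pairing of the Taylor polynomials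
(`T5BergmanModelUnitary.pairing_partialSum_partialSum` + Cauchy–Schwarz + `S_N f → f` in `A_k`), and
then, through the scalar identity of `T5BergmanModelUnitary`, the **`ℓ²`-extension of the invariant form
of the abstract module** to ALL of `A_k`:

  `⟨f, g⟩_k = π/(k-1) · Σₙ conj(bₙ λₙ) (aₙ λₙ) cₙ`   (`hasSum_pairing_form`),

the summands being exactly those of `T5Sl2LowestWeightUnitary.form k (D b) (D a)` on the `K`-finite
vectors: the Hilbert-space completion of the abstract unitary module IS `A_k` with the Bergman pairing,
coefficient by coefficient.

Blind lane: Mathlib + the HodgeRepro2 prefix only; no sorry; axioms ⊆ {propext, Classical.choice,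
Quot.sound}.
-/

namespace Summit.Ventures.HodgeRepro2.T5BergmanParsevalPolarized

open MeasureTheory Metric Filter Topology
open T5SU11Unimodular T5BergmanCoefficient T5BergmanPairing T5BergmanUnitary T5BergmanFourier
  T5BergmanKernel T5BergmanParseval T5BergmanProjection T5BergmanCoefficientL2 T5BergmanMatrixCoeff
  T5BergmanModelEquiv T5Sl2LowestWeightUnitary T5BergmanModelUnitary
open scoped Real

/-- Cauchy–Schwarz in the form `‖⟨f, g⟩_k‖ ≤ √(⟨f,f⟩_k ⟨g,g⟩_k)`. -/
lemma norm_pairing_le (k : ℕ) {f g : ℂ → ℂ} (hf : ContinuousOn f (ball 0 1))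
    (hg : ContinuousOn g (ball 0 1))
    (hfi : IntegrableOn (fun z => ‖f z‖ ^ 2 * (1 - ‖z‖ ^ 2) ^ (k - 2)) (ball (0 : ℂ) 1))
    (hgi : IntegrableOn (fun z => ‖g z‖ ^ 2 * (1 - ‖z‖ ^ 2) ^ (k - 2)) (ball (0 : ℂ) 1)) :
    ‖pairing k f g‖ ≤ Real.sqrt ((pairing k f f).re * (pairing k g g).re) := by
  rw [← Real.sqrt_sq (norm_nonneg (pairing k f g))]
  exact Real.sqrt_le_sqrt (norm_pairing_sq_le k hf hg hfi hgi)

/-- **The pairing of the Taylor polynomials converges to the pairing**: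
`⟨S_N f, S_N g⟩_k → ⟨f, g⟩_k` for holomorphic `f, g ∈ A_k`. -/
theorem tendsto_pairing_partialSum (k : ℕ) (hk : 2 ≤ k) (a : ℕ → ℂ) (f : ℂ → ℂ)
    (hfa : ∀ w ∈ ball (0 : ℂ) 1, HasSum (fun n => a n * w ^ n) (f w))
    (hfint : IntegrableOn (fun w => ‖f w‖ ^ 2 * (1 - ‖w‖ ^ 2) ^ (k - 2)) (ball (0 : ℂ) 1))
    (b : ℕ → ℂ) (g : ℂ → ℂ) (hgb : ∀ w ∈ ball (0 : ℂ) 1, HasSum (fun n => b n * w ^ n) (g w))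
    (hgint : IntegrableOn (fun w => ‖g w‖ ^ 2 * (1 - ‖w‖ ^ 2) ^ (k - 2)) (ball (0 : ℂ) 1)) :
    Tendsto (fun N => pairing k (partialSum a N) (partialSum b N)) atTop (𝓝 (pairing k f g)) := by
  have hfc : ContinuousOn f (ball 0 1) := continuousOn_ball a f hfa
  have hgc : ContinuousOn g (ball 0 1) := continuousOn_ball b g hgb
  have hSc : ∀ N, ContinuousOn (partialSum a N) (ball 0 1) := fun N =>
    (differentiable_partialSum a N).continuous.continuousOn
  have hTc : ∀ N, ContinuousOn (partialSum b N) (ball 0 1) := fun N =>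
    (differentiable_partialSum b N).continuous.continuousOn
  -- the decomposition `⟨f, g⟩ - ⟨S_N, T_N⟩ = ⟨f - S_N, g⟩ + ⟨S_N, g - T_N⟩`
  have hdec : ∀ N, pairing k f g - pairing k (partialSum a N) (partialSum b N) =
      pairing k (f - partialSum a N) g + pairing k (partialSum a N) (g - partialSum b N) := by
    intro N
    have e1 : pairing k f g = pairing k (partialSum a N) g + pairing k (f - partialSum a N) g := by
      rw [← pairing_add_left k (integrableOn_mul_conj k (hSc N) hgc (integrableOn_partialSum k a N) hgint)
        (integrableOn_mul_conj k ((hfc.sub (hSc N))) hgc (integrableOn_sub_partialSum k hk a f hfa hfint N)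
        hgint)]
      congr 1
      funext z
      simp only [Pi.add_apply, Pi.sub_apply]
      ring
    have e2 : pairing k (partialSum a N) g =
        pairing k (partialSum a N) (partialSum b N) + pairing k (partialSum a N) (g - partialSum b N) := by
      rw [← pairing_add_right k (integrableOn_mul_conj k (hSc N) (hTc N) (integrableOn_partialSum k a N)
        (integrableOn_partialSum k b N)) (integrableOn_mul_conj k (hSc N) (hgc.sub (hTc N))
        (integrableOn_partialSum k a N) (integrableOn_sub_partialSum k hk b g hgb hgint N))]
      congr 1
      funext z
      simp only [Pi.add_apply, Pi.sub_apply]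
      ring
    rw [e1, e2]
    ring
  -- the bounds
  have hB : ∀ N, ‖pairing k f g - pairing k (partialSum a N) (partialSum b N)‖ ≤
      Real.sqrt ((pairing k (f - partialSum a N) (f - partialSum a N)).re * (pairing k g g).re) +
        Real.sqrt ((pairing k f f).re * (pairing k (g - partialSum b N) (g - partialSum b N)).re) := by
    intro N
    rw [hdec N]
    refine (norm_add_le _ _).trans (add_le_add ?_ ?_)
    · exact norm_pairing_le k (hfc.sub (hSc N)) hgc (integrableOn_sub_partialSum k hk a f hfa hfint N)
        hgint
    · refine (norm_pairing_le k (hSc N) (hgc.sub (hTc N)) (integrableOn_partialSum k a N)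
        (integrableOn_sub_partialSum k hk b g hgb hgint N)).trans (Real.sqrt_le_sqrt ?_)
      refine mul_le_mul_of_nonneg_right ?_ (pairing_self_nonneg k _).1
      rw [pairing_partialSum_self k hk a N]
      exact bessel k hk a f hfa hfint N
  -- both bounds tend to `0`
  have h1 := (tendsto_pairing_sub_partialSum k hk a f hfa hfint).mul_const (pairing k g g).re
  rw [zero_mul] at h1
  have h1' := h1.sqrt
  rw [Real.sqrt_zero] at h1'
  have h2 := (tendsto_pairing_sub_partialSum k hk b g hgb hgint).const_mul (pairing k f f).re
  rw [mul_zero] at h2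
  have h2' := h2.sqrt
  rw [Real.sqrt_zero] at h2'
  have h3 := h1'.add h2'
  rw [add_zero] at h3
  rw [tendsto_iff_norm_sub_tendsto_zero]
  refine squeeze_zero (fun N => norm_nonneg _) (fun N => ?_) h3
  rw [norm_sub_rev]
  exact hB N

/-- The terms `aₙ conj(bₙ) ⟨zⁿ,zⁿ⟩_k` are absolutely summable (by Parseval for `f` and `g`). -/
lemma summable_norm_term (k : ℕ) (hk : 2 ≤ k) (a : ℕ → ℂ) (f : ℂ → ℂ)
    (hfa : ∀ w ∈ ball (0 : ℂ) 1, HasSum (fun n => a n * w ^ n) (f w))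
    (hfint : IntegrableOn (fun w => ‖f w‖ ^ 2 * (1 - ‖w‖ ^ 2) ^ (k - 2)) (ball (0 : ℂ) 1))
    (b : ℕ → ℂ) (g : ℂ → ℂ) (hgb : ∀ w ∈ ball (0 : ℂ) 1, HasSum (fun n => b n * w ^ n) (g w))
    (hgint : IntegrableOn (fun w => ‖g w‖ ^ 2 * (1 - ‖w‖ ^ 2) ^ (k - 2)) (ball (0 : ℂ) 1)) :
    Summable fun n => ‖a n * (starRingEnd ℂ) (b n) * ((monomialNormSq k n : ℝ) : ℂ)‖ := by
  have hf := (hasSum_pairing_self k hk a f hfa hfint).summable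
  have hg := (hasSum_pairing_self k hk b g hgb hgint).summable
  refine Summable.of_nonneg_of_le (fun n => norm_nonneg _) (fun n => ?_) ((hf.add hg).div_const 2)
  rw [norm_mul, norm_mul, Complex.norm_conj, Complex.norm_real, Real.norm_eq_abs,
    abs_of_pos (monomialNormSq_pos k n)]
  have hm := (monomialNormSq_pos k n).le
  nlinarith [sq_nonneg (‖a n‖ - ‖b n‖), mul_nonneg (mul_nonneg (norm_nonneg (a n)) (norm_nonneg (b n))) hm]

/-- **The polarised Parseval identity**: `⟨f, g⟩_k = Σₙ aₙ conj(bₙ) ⟨zⁿ, zⁿ⟩_k` for holomorphic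
`f = Σ aₙ zⁿ`, `g = Σ bₙ zⁿ` in `A_k` (`k ≥ 2`). -/
theorem hasSum_pairing (k : ℕ) (hk : 2 ≤ k) (a : ℕ → ℂ) (f : ℂ → ℂ)
    (hfa : ∀ w ∈ ball (0 : ℂ) 1, HasSum (fun n => a n * w ^ n) (f w))
    (hfint : IntegrableOn (fun w => ‖f w‖ ^ 2 * (1 - ‖w‖ ^ 2) ^ (k - 2)) (ball (0 : ℂ) 1))
    (b : ℕ → ℂ) (g : ℂ → ℂ) (hgb : ∀ w ∈ ball (0 : ℂ) 1, HasSum (fun n => b n * w ^ n) (g w))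
    (hgint : IntegrableOn (fun w => ‖g w‖ ^ 2 * (1 - ‖w‖ ^ 2) ^ (k - 2)) (ball (0 : ℂ) 1)) :
    HasSum (fun n => a n * (starRingEnd ℂ) (b n) * ((monomialNormSq k n : ℝ) : ℂ)) (pairing k f g) := by
  rw [hasSum_iff_tendsto_nat_of_summable_norm (summable_norm_term k hk a f hfa hfint b g hgb hgint)]
  refine (tendsto_pairing_partialSum k hk a f hfa hfint b g hgb hgint).congr fun N => ?_
  exact pairing_partialSum_partialSum k hk a b N

/-- The same for holomorphic `f, g ∈ A_k` with their Taylor coefficients. -/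
theorem hasSum_pairing_taylor (k : ℕ) (hk : 2 ≤ k) (f g : ℂ → ℂ) (hf : DifferentiableOn ℂ f (ball 0 1))
    (hfint : IntegrableOn (fun w => ‖f w‖ ^ 2 * (1 - ‖w‖ ^ 2) ^ (k - 2)) (ball (0 : ℂ) 1))
    (hg : DifferentiableOn ℂ g (ball 0 1))
    (hgint : IntegrableOn (fun w => ‖g w‖ ^ 2 * (1 - ‖w‖ ^ 2) ^ (k - 2)) (ball (0 : ℂ) 1)) :
    HasSum (fun n => taylorCoeff f n * (starRingEnd ℂ) (taylorCoeff g n) * ((monomialNormSq k n : ℝ) : ℂ))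
      (pairing k f g) :=
  hasSum_pairing k hk _ f (hasSum_taylor f hf) hfint _ g (hasSum_taylor g hg) hgint

/-- **The `ℓ²`-extension of the invariant form to all of `A_k`**:
`⟨f, g⟩_k = π/(k-1) · Σₙ conj(bₙ λₙ) (aₙ λₙ) cₙ` — the summands are those of
`T5Sl2LowestWeightUnitary.form k (D b) (D a)` (`T5BergmanModelUnitary.pairing_ofCoeffs`), now for every
pair of holomorphic vectors of the completion. -/
theorem hasSum_pairing_form (k : ℕ) (hk : 2 ≤ k) (a : ℕ → ℂ) (f : ℂ → ℂ)
    (hfa : ∀ w ∈ ball (0 : ℂ) 1, HasSum (fun n => a n * w ^ n) (f w))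
    (hfint : IntegrableOn (fun w => ‖f w‖ ^ 2 * (1 - ‖w‖ ^ 2) ^ (k - 2)) (ball (0 : ℂ) 1))
    (b : ℕ → ℂ) (g : ℂ → ℂ) (hgb : ∀ w ∈ ball (0 : ℂ) 1, HasSum (fun n => b n * w ^ n) (g w))
    (hgint : IntegrableOn (fun w => ‖g w‖ ^ 2 * (1 - ‖w‖ ^ 2) ^ (k - 2)) (ball (0 : ℂ) 1)) :
    HasSum (fun n => ((π / ((k : ℝ) - 1) : ℝ) : ℂ) *
        ((starRingEnd ℂ) (b n * lam k n) * (a n * lam k n) * ((normCoeff (k : ℝ) n : ℝ) : ℂ)))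
      (pairing k f g) := by
  refine (hasSum_pairing k hk a f hfa hfint b g hgb hgint).congr_fun fun n => ?_
  have hk1 : ((k : ℝ) - 1) ≠ 0 := by
    have : (2 : ℝ) ≤ k := by exact_mod_cast hk
    intro h
    linarith
  have hπ : (π : ℝ) ≠ 0 := Real.pi_ne_zero
  have e : ((monomialNormSq k n : ℝ) : ℂ) =
      ((π / ((k : ℝ) - 1) : ℝ) : ℂ) *
        (lam k n * (starRingEnd ℂ) (lam k n) * ((normCoeff (k : ℝ) n : ℝ) : ℂ)) := by
    rw [lam_mul_conj_mul_normCoeff k hk n, ← mul_assoc, ← Complex.ofReal_mul,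
      show π / ((k : ℝ) - 1) * (((k : ℝ) - 1) / π) = 1 by field_simp, Complex.ofReal_one, one_mul]
  rw [map_mul, e]
  ring

end Summit.Ventures.HodgeRepro2.T5BergmanParsevalPolarized
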